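import Mathlib
import Literature.NumberTheory.Transcendental.AssociatorsHexagonProofs
import HarnessLib

/-!
# Evaluation calculus for non-commutative series: graded substitution, multiplicativity,
# and the exponential law for group-like series

Sibling file of `Associators.lean` (Part B.1 of the proof of Furusho's theorem
`furusho_pentagon_doubleShuffle` [Furusho2011, Thm 1.2]; everything here is folklore Hopf-algebra
calculus, proved, no named facts). For a series `φ ∈ R⟨⟨α⟩⟩` and a substitution of letters
`v : α → A` into an `R`-algebra:

* `NCSeries.evalW n v φ = Σ_{|w| = n} c_w(φ) v(w)` — the weight-`n` part of Furusho's
  `φ(v(X₀), v(X₁))`, so that `NCSeries.evalTrunc N v φ = Σ_{n ≤ N} evalW n v φ`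
  (`NCSeries.evalTrunc_eq_sum_evalW`); `NCSeries.lderiv a φ` — the left derivative
  `c_w(∂_a φ) = c_{a w}(φ)`, with `evalW (n+1) v φ = Σ_a v(a) · evalW n v (∂_a φ)`.
* `NCSeries.evalW_mul` — `evalW n v (φ ψ) = Σ_{i+j=n} evalW i v φ · evalW j v ψ` (the substitution
  is a graded algebra map); hence `NCSeries.evalTrunc_mul_of_mem`: `evalTrunc N v` is
  multiplicative as soon as the values of `v` lie in a submodule `S` all of whose products of
  length `> N` vanish (as in the
  weight-truncated Drinfeld–Kohno algebras: `DrinfeldKohnoTrunc.list_prod_eq_zero_of_mem_genSpan`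
  of `AssociatorsHexagonProofs.lean`).
* `NCSeries.evalW_add_eq_sum_shEval₂` — for two substitutions `v₁, v₂` whose values commute with
  each other, `evalW n (v₁ + v₂) φ = Σ_{i+j=n} Σ_{|u|=i,|u'|=j} (Σ_{w ∈ u ш u'} c_w(φ)) v₁(u) v₂(u')`:
  the substitution `x ↦ v₁(x) + v₂(x)` is the convolution `m ∘ (v₁ ⊗ v₂) ∘ Δ` for the coproduct
  `Δ` with primitive letters, transposed to the shuffle product [Reutenauer1993, §1.4–1.5].
* **Exponential law** `NCSeries.IsGroupLike.evalW_add`: for GROUP-LIKE `φ`,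
  `evalW n (v₁ + v₂) φ = Σ_{i+j=n} evalW i v₁ φ · evalW j v₂ φ`, i.e.
  `φ(A + C, B + D) = φ(A, B) φ(C, D)` when `{A, B}` commute with `{C, D}`
  (`NCSeries.IsGroupLike.subst₂_add_add`); in particular Furusho's remark
  "if `φ` is commutator group-like, `φ(A + C, B) = φ(A, B + C) = φ(A, B)` with `[A,C] = [B,C] = 0`"
  [Furusho2010, proof of Lemma 5] (`NCSeries.IsGroupLike.subst₂_add_left/right`) and
  `φ(A, B) = 1` for commuting `A, B` (`NCSeries.IsGroupLike.subst₂_eq_one_of_commute`), used to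
  pass from the pentagon to its 5-cycle / 2-cycle forms.

## References

* H. Furusho, *Pentagon and hexagon equations*, Ann. of Math. 171 (2010), 545–556, proof of
  Lemma 5 (arXiv:math/0702128, p. 7). [Furusho2010]
* H. Furusho, *Double shuffle relation for associators*, Ann. of Math. 174 (2011), §2, §5.
  [Furusho2011]
* C. Reutenauer, *Free Lie algebras*, Oxford (1993), §1.4–1.5 (shuffle product, coproduct,
  group-like = exponential-type characters), Thm 3.2. [Reutenauer1993]
-/

noncomputable section

open scoped BigOperators

namespace Literature.NumberTheory.Transcendental

universe u v

namespace NCSeries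

/-! ## B.1.1 Graded evaluation and left derivatives -/

section Deriv

variable {α : Type u} {R : Type v}

/-- The **left derivative** `∂_a φ`: `c_w(∂_a φ) = c_{a w}(φ)`. [folklore] -/
def lderiv (a : α) (φ : NCSeries α R) : NCSeries α R := fun w => φ (a :: w)

/-- `c_w(∂_a φ) = c_{a w}(φ)`. [folklore] -/
@[simp] theorem lderiv_apply (a : α) (φ : NCSeries α R) (w : List α) : lderiv a φ w = φ (a :: w) :=
  rfl

variable [CommSemiring R]

/-- `∂_a` is additive. [folklore] -/
@[simp] theorem lderiv_add (a : α) (φ ψ : NCSeries α R) :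
    lderiv a (φ + ψ) = lderiv a φ + lderiv a ψ := rfl

/-- **Leibniz rule for the left derivative**: `c_{a w}(φ ψ) = c_∅(φ) c_{a w}(ψ) + c_w((∂_a φ) ψ)`
(a deconcatenation of `a w` is trivial on the left or starts with `a`). [folklore] -/
theorem mul_apply_cons (φ ψ : NCSeries α R) (a : α) (w : List α) :
    (φ * ψ) (a :: w) = φ [] * ψ (a :: w) + (lderiv a φ * ψ) w := by
  rw [mul_apply, mul_apply]
  simp only [splits, Finset.sum_map, Function.Embedding.coeFn_mk]
  rw [Fin.sum_univ_succ]
  simp only [Fin.val_zero, List.take_zero, List.drop_zero, Fin.val_succ, List.take_succ_cons,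
    List.drop_succ_cons]
  rfl

/-- `∂_a (φ ψ) = C(c_∅ φ) ∂_a ψ + (∂_a φ) ψ`. [folklore] -/
theorem lderiv_mul (φ ψ : NCSeries α R) (a : α) :
    lderiv a (φ * ψ) = C (φ []) * lderiv a ψ + lderiv a φ * ψ := by
  ext w
  rw [lderiv_apply, mul_apply_cons, add_apply, C_mul_apply, lderiv_apply]

end Deriv

section Graded

variable {α : Type u} {R : Type v} [CommSemiring R] {A : Type*} [Semiring A] [Algebra R A]

/-- Triangular re-indexing: `Σ_{n ≤ N} Σ_{i+j=n} F i j = Σ_{i ≤ N} Σ_{j ≤ N-i} F i j`. [folklore] -/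
theorem sum_range_sum_antidiagonal {M : Type*} [AddCommMonoid M] (F : ℕ → ℕ → M) : ∀ N : ℕ,
    ∑ n ∈ Finset.range (N + 1), ∑ p ∈ Finset.HasAntidiagonal.antidiagonal n, F p.1 p.2 =
      ∑ i ∈ Finset.range (N + 1), ∑ j ∈ Finset.range (N + 1 - i), F i j
  | 0 => by simp
  | N + 1 => by
    rw [Finset.sum_range_succ, sum_range_sum_antidiagonal F N,
      Finset.Nat.sum_antidiagonal_eq_sum_range_succ_mk, Finset.sum_range_succ (n := N + 1),
      Finset.sum_range_succ (f := fun i => ∑ j ∈ Finset.range (N + 1 + 1 - i), F i j) (n := N + 1)]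
    simp only [show N + 1 + 1 - (N + 1) = 1 by omega, Nat.sub_self, Finset.sum_range_one]
    rw [← add_assoc, ← Finset.sum_add_distrib]
    congr 1
    refine Finset.sum_congr rfl fun i hi => ?_
    rw [Finset.mem_range] at hi
    rw [show N + 1 + 1 - i = (N + 1 - i) + 1 by omega, Finset.sum_range_succ]

variable (S : Submodule R A) in
/-- Products of values of a substitution with values in a submodule `S` whose long products vanish
are zero beyond the truncation order. [folklore] -/
theorem prod_map_mul_prod_map_eq_zero {N : ℕ} (hS : ∀ l : List A, (∀ x ∈ l, x ∈ S) →
    N < l.length → l.prod = 0) {v : α → A} (hv : ∀ a, v a ∈ S) {i j : ℕ} (hij : N < i + j)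
    (f : Fin i → α) (g : Fin j → α) :
    ((List.ofFn f).map v).prod * ((List.ofFn g).map v).prod = 0 := by
  rw [← List.prod_append, ← List.map_append]
  refine hS _ (fun x hx => ?_) (by simpa using hij)
  rw [List.mem_map] at hx
  obtain ⟨a, -, rfl⟩ := hx
  exact hv a

variable [Fintype α]

/-- The **weight-`n` part of the substitution** `x ↦ v(x)`:
`evalW n v φ = Σ_{|w| = n} c_w(φ) · v(w₁) ⋯ v(w_n)` (words of length `n` as `List.ofFn f`).
[folklore] -/
def evalW (n : ℕ) (v : α → A) (φ : NCSeries α R) : A :=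
  ∑ f : Fin n → α, φ (List.ofFn f) • ((List.ofFn f).map v).prod

/-- `evalTrunc N v φ = Σ_{n ≤ N} evalW n v φ`. [folklore] -/
theorem evalTrunc_eq_sum_evalW (N : ℕ) (v : α → A) (φ : NCSeries α R) :
    evalTrunc N v φ = ∑ n ∈ Finset.range (N + 1), evalW n v φ := rfl

/-- Summing over `(n+1)`-tuples is summing over the head and the tail. [folklore] -/
theorem sum_fin_succ_fun {M : Type*} [AddCommMonoid M] (n : ℕ) (G : (Fin (n + 1) → α) → M) :
    ∑ f : Fin (n + 1) → α, G f = ∑ a : α, ∑ g : Fin n → α, G (Fin.cons a g) := by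
  rw [← Fintype.sum_prod_type']
  exact (Fintype.sum_equiv (Fin.consEquiv fun _ => α) _ _ fun p => rfl).symm

/-- In weight `0` only the empty word contributes: `evalW 0 v φ = c_∅(φ) · 1`. [folklore] -/
@[simp] theorem evalW_zero (v : α → A) (φ : NCSeries α R) : evalW 0 v φ = φ [] • (1 : A) := by
  simp [evalW]

/-- **Recursion in the weight**: `evalW (n+1) v φ = Σ_a v(a) · evalW n v (∂_a φ)`. [folklore] -/
theorem evalW_succ (n : ℕ) (v : α → A) (φ : NCSeries α R) :
    evalW (n + 1) v φ = ∑ a : α, v a * evalW n v (lderiv a φ) := by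
  rw [evalW, sum_fin_succ_fun]
  refine Finset.sum_congr rfl fun a _ => ?_
  rw [evalW, Finset.mul_sum]
  refine Finset.sum_congr rfl fun g _ => ?_
  rw [List.ofFn_cons, List.map_cons, List.prod_cons, lderiv_apply, Algebra.mul_smul_comm]

/-- `evalW` is additive in the series. [folklore] -/
theorem evalW_add (n : ℕ) (v : α → A) (φ ψ : NCSeries α R) :
    evalW n v (φ + ψ) = evalW n v φ + evalW n v ψ := by
  simp [evalW, add_smul, Finset.sum_add_distrib]

/-- `evalW n v (C r · ψ) = r • evalW n v ψ`. [folklore] -/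
theorem evalW_C_mul (n : ℕ) (v : α → A) (r : R) (ψ : NCSeries α R) :
    evalW n v (C r * ψ) = r • evalW n v ψ := by
  simp [evalW, Finset.smul_sum, smul_smul]

/-- The unit series: `evalW n v 1 = [n = 0]`. [folklore] -/
theorem evalW_one (n : ℕ) (v : α → A) : evalW n v (1 : NCSeries α R) = if n = 0 then 1 else 0 := by
  cases n with
  | zero => simp
  | succ n =>
    rw [if_neg (Nat.succ_ne_zero n), evalW]
    refine Finset.sum_eq_zero fun f _ => ?_
    rw [List.ofFn_succ, one_apply_cons, zero_smul]

omit [Fintype α] in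
/-- `c_∅(φ ψ) = c_∅(φ) c_∅(ψ)`. [folklore] -/
theorem mul_apply_nil' (φ ψ : NCSeries α R) : (φ * ψ) [] = φ [] * ψ [] := by
  simp [mul_apply, splits]

/-- **The substitution is a graded algebra map**:
`evalW n v (φ ψ) = Σ_{i+j=n} evalW i v φ · evalW j v ψ`. [folklore] -/
theorem evalW_mul (v : α → A) : ∀ (n : ℕ) (φ ψ : NCSeries α R),
    evalW n v (φ * ψ) =
      ∑ p ∈ Finset.HasAntidiagonal.antidiagonal n, evalW p.1 v φ * evalW p.2 v ψ
  | 0, φ, ψ => by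
    rw [Finset.Nat.antidiagonal_zero, Finset.sum_singleton, evalW_zero, evalW_zero, evalW_zero,
      mul_apply_nil', smul_mul_smul_comm, one_mul]
  | n + 1, φ, ψ => by
    have hL : evalW (n + 1) v (φ * ψ) = ∑ a : α, v a * (φ [] • evalW n v (lderiv a ψ)) +
        ∑ a : α, ∑ p ∈ Finset.HasAntidiagonal.antidiagonal n,
          v a * (evalW p.1 v (lderiv a φ) * evalW p.2 v ψ) := by
      rw [evalW_succ, ← Finset.sum_add_distrib]
      refine Finset.sum_congr rfl fun a _ => ?_
      rw [lderiv_mul, evalW_add, evalW_C_mul, evalW_mul v n, mul_add, Finset.mul_sum]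
    rw [hL, Finset.Nat.sum_antidiagonal_succ, evalW_zero]
    simp only [evalW_succ]
    congr 1
    · rw [smul_mul_assoc, one_mul, Finset.smul_sum]
      refine Finset.sum_congr rfl fun a _ => ?_
      rw [Algebra.mul_smul_comm]
    · rw [Finset.sum_comm]
      refine Finset.sum_congr rfl fun p _ => ?_
      rw [Finset.sum_mul]
      refine Finset.sum_congr rfl fun a _ => ?_
      rw [mul_assoc]

variable (S : Submodule R A)

/-- Beyond the truncation order the graded pieces multiply to zero. [folklore] -/
theorem evalW_mul_evalW_eq_zero {N : ℕ} (hS : ∀ l : List A, (∀ x ∈ l, x ∈ S) →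
    N < l.length → l.prod = 0) {v : α → A} (hv : ∀ a, v a ∈ S) {i j : ℕ} (hij : N < i + j)
    (φ ψ : NCSeries α R) : evalW i v φ * evalW j v ψ = 0 := by
  rw [evalW, evalW, Finset.sum_mul_sum]
  refine Finset.sum_eq_zero fun f _ => Finset.sum_eq_zero fun g _ => ?_
  rw [smul_mul_smul_comm, prod_map_mul_prod_map_eq_zero S hS hv hij, smul_zero]

/-- **`evalTrunc N v` is multiplicative** when the values of `v` lie in a submodule `S` all of whose
products of more than `N` factors vanish (e.g. the span of the generators of a weight-truncated
algebra): then `φ ↦ φ(v)` is the algebra map `R⟨⟨α⟩⟩ → A` it stands for. [folklore] -/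
theorem evalTrunc_mul_of_mem {N : ℕ}
    (hS : ∀ l : List A, (∀ x ∈ l, x ∈ S) → N < l.length → l.prod = 0)
    {v : α → A} (hv : ∀ a, v a ∈ S) (φ ψ : NCSeries α R) :
    evalTrunc N v (φ * ψ) = evalTrunc N v φ * evalTrunc N v ψ := by
  simp only [evalTrunc_eq_sum_evalW, evalW_mul v, Finset.sum_mul_sum]
  rw [sum_range_sum_antidiagonal (fun i j => evalW i v φ * evalW j v ψ) N]
  refine Finset.sum_congr rfl fun i hi => ?_
  rw [Finset.mem_range] at hi
  refine Finset.sum_subset (Finset.range_subset_range.mpr (by omega)) fun j hj hj' => ?_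
  rw [Finset.mem_range] at hj hj'
  exact evalW_mul_evalW_eq_zero S hS hv (by omega) φ ψ

/-- Powers: `evalTrunc N v (φ ^ m) = (evalTrunc N v φ) ^ m` under the same hypothesis. [folklore] -/
theorem evalTrunc_pow_of_mem {N : ℕ}
    (hS : ∀ l : List A, (∀ x ∈ l, x ∈ S) → N < l.length → l.prod = 0)
    {v : α → A} (hv : ∀ a, v a ∈ S) (φ : NCSeries α R) (m : ℕ) :
    evalTrunc N v (φ ^ m) = evalTrunc N v φ ^ m := by
  induction m with
  | zero => simp
  | succ m ih => rw [pow_succ, evalTrunc_mul_of_mem S hS hv, ih, pow_succ]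

end Graded

/-! ## B.1.2 The substitution `x ↦ v₁(x) + v₂(x)` and the shuffle coproduct -/

section Shuffle

variable {α : Type u} {R : Type v} [CommSemiring R] {A : Type*} [Semiring A] [Algebra R A]

/-- The shuffle pairing `Sh_φ(u, u') = Σ_{w ∈ u ш u'} c_w(φ)` — the coefficient of `u ⊗ u'` in
`Δ φ` for the coproduct with primitive letters (transpose of `ш`, [Reutenauer1993, §1.5]).
[cite: Reutenauer1993, §1.5] -/
def shPair (φ : NCSeries α R) (u u' : List α) : R := ((MZV.shuffleWord u u').map φ).sum

/-- `Sh_φ(∅, ∅) = c_∅(φ)`. [folklore] -/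
@[simp] theorem shPair_nil_nil (φ : NCSeries α R) : shPair φ [] [] = φ [] := by simp [shPair]

/-- `Sh_φ(a u, ∅) = Sh_{∂_a φ}(u, ∅)`. [folklore] -/
theorem shPair_cons_nil (φ : NCSeries α R) (a : α) (u : List α) :
    shPair φ (a :: u) [] = shPair (lderiv a φ) u [] := by simp [shPair]

/-- `Sh_φ(∅, b u') = Sh_{∂_b φ}(∅, u')`. [folklore] -/
theorem shPair_nil_cons (φ : NCSeries α R) (b : α) (u' : List α) :
    shPair φ [] (b :: u') = shPair (lderiv b φ) [] u' := by simp [shPair]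

/-- The shuffle recursion transposed: `Sh_φ(a u, b u') = Sh_{∂_a φ}(u, b u') + Sh_{∂_b φ}(a u, u')`.
[cite: Reutenauer1993, §1.4] -/
theorem shPair_cons_cons (φ : NCSeries α R) (a b : α) (u u' : List α) :
    shPair φ (a :: u) (b :: u') =
      shPair (lderiv a φ) u (b :: u') + shPair (lderiv b φ) (a :: u) u' := by
  simp only [shPair, MZV.shuffleWord_cons_cons, List.map_append, List.map_map, List.sum_append]
  rfl

variable [Fintype α]

/-- The `(i, j)`-graded piece of `m ∘ (v₁ ⊗ v₂) ∘ Δ` applied to `φ`: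
`Σ_{|u|=i, |u'|=j} Sh_φ(u, u') · v₁(u) v₂(u')`. [folklore] -/
def shEval₂ (i j : ℕ) (v₁ v₂ : α → A) (φ : NCSeries α R) : A :=
  ∑ f : Fin i → α, ∑ g : Fin j → α,
    shPair φ (List.ofFn f) (List.ofFn g) • (((List.ofFn f).map v₁).prod * ((List.ofFn g).map v₂).prod)

/-- `shEval₂ 0 0 = c_∅(φ) · 1`. [folklore] -/
@[simp] theorem shEval₂_zero_zero (v₁ v₂ : α → A) (φ : NCSeries α R) :
    shEval₂ 0 0 v₁ v₂ φ = φ [] • (1 : A) := by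
  simp [shEval₂]

/-- Left recursion with empty right word. [folklore] -/
theorem shEval₂_succ_zero (i : ℕ) (v₁ v₂ : α → A) (φ : NCSeries α R) :
    shEval₂ (i + 1) 0 v₁ v₂ φ = ∑ a : α, v₁ a * shEval₂ i 0 v₁ v₂ (lderiv a φ) := by
  simp only [shEval₂, Fintype.sum_unique, List.ofFn_zero, List.map_nil, List.prod_nil, mul_one]
  rw [sum_fin_succ_fun]
  refine Finset.sum_congr rfl fun a _ => ?_
  rw [Finset.mul_sum]
  refine Finset.sum_congr rfl fun f _ => ?_
  rw [List.ofFn_cons, shPair_cons_nil, List.map_cons, List.prod_cons, Algebra.mul_smul_comm]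

/-- Right recursion with empty left word. [folklore] -/
theorem shEval₂_zero_succ (j : ℕ) (v₁ v₂ : α → A) (φ : NCSeries α R) :
    shEval₂ 0 (j + 1) v₁ v₂ φ = ∑ b : α, v₂ b * shEval₂ 0 j v₁ v₂ (lderiv b φ) := by
  simp only [shEval₂, Fintype.sum_unique, List.ofFn_zero, List.map_nil, List.prod_nil, one_mul]
  rw [sum_fin_succ_fun]
  refine Finset.sum_congr rfl fun b _ => ?_
  rw [Finset.mul_sum]
  refine Finset.sum_congr rfl fun g _ => ?_
  rw [List.ofFn_cons, shPair_nil_cons, List.map_cons, List.prod_cons, Algebra.mul_smul_comm]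

/-- Two-sided recursion (the values of `v₂` must commute with those of `v₁`). [folklore] -/
theorem shEval₂_succ_succ (i j : ℕ) {v₁ v₂ : α → A} (hc : ∀ a b, Commute (v₁ a) (v₂ b))
    (φ : NCSeries α R) :
    shEval₂ (i + 1) (j + 1) v₁ v₂ φ = ∑ a : α, v₁ a * shEval₂ i (j + 1) v₁ v₂ (lderiv a φ) +
      ∑ b : α, v₂ b * shEval₂ (i + 1) j v₁ v₂ (lderiv b φ) := by
  -- expand the left-hand side by the transposed shuffle recursion
  have h1 : shEval₂ (i + 1) (j + 1) v₁ v₂ φ = ∑ a : α, ∑ f : Fin i → α, ∑ b : α, ∑ g : Fin j → α,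
      (shPair (lderiv a φ) (List.ofFn f) (b :: List.ofFn g) +
        shPair (lderiv b φ) (a :: List.ofFn f) (List.ofFn g)) •
        ((v₁ a * ((List.ofFn f).map v₁).prod) * (v₂ b * ((List.ofFn g).map v₂).prod)) := by
    unfold shEval₂
    rw [sum_fin_succ_fun (M := A) (n := i)]
    refine Finset.sum_congr rfl fun a _ => Finset.sum_congr rfl fun f _ => ?_
    rw [sum_fin_succ_fun (M := A) (n := j)]
    refine Finset.sum_congr rfl fun b _ => Finset.sum_congr rfl fun g _ => ?_
    rw [List.ofFn_cons, List.ofFn_cons, shPair_cons_cons, List.map_cons, List.prod_cons,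
      List.map_cons, List.prod_cons]
  -- the two halves
  have hA : ∑ a : α, v₁ a * shEval₂ i (j + 1) v₁ v₂ (lderiv a φ) =
      ∑ a : α, ∑ f : Fin i → α, ∑ b : α, ∑ g : Fin j → α,
        shPair (lderiv a φ) (List.ofFn f) (b :: List.ofFn g) •
          ((v₁ a * ((List.ofFn f).map v₁).prod) * (v₂ b * ((List.ofFn g).map v₂).prod)) := by
    refine Finset.sum_congr rfl fun a _ => ?_
    unfold shEval₂
    rw [Finset.mul_sum]
    refine Finset.sum_congr rfl fun f _ => ?_
    rw [sum_fin_succ_fun (M := A) (n := j), Finset.mul_sum]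
    refine Finset.sum_congr rfl fun b _ => ?_
    rw [Finset.mul_sum]
    refine Finset.sum_congr rfl fun g _ => ?_
    rw [List.ofFn_cons, List.map_cons, List.prod_cons, Algebra.mul_smul_comm, mul_assoc]
  have hB : ∑ b : α, v₂ b * shEval₂ (i + 1) j v₁ v₂ (lderiv b φ) =
      ∑ a : α, ∑ f : Fin i → α, ∑ b : α, ∑ g : Fin j → α,
        shPair (lderiv b φ) (a :: List.ofFn f) (List.ofFn g) •
          ((v₁ a * ((List.ofFn f).map v₁).prod) * (v₂ b * ((List.ofFn g).map v₂).prod)) := by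
    have step : ∀ b : α, v₂ b * shEval₂ (i + 1) j v₁ v₂ (lderiv b φ) =
        ∑ a : α, ∑ f : Fin i → α, ∑ g : Fin j → α,
          shPair (lderiv b φ) (a :: List.ofFn f) (List.ofFn g) •
            ((v₁ a * ((List.ofFn f).map v₁).prod) * (v₂ b * ((List.ofFn g).map v₂).prod)) := by
      intro b
      unfold shEval₂
      rw [sum_fin_succ_fun (M := A) (n := i), Finset.mul_sum]
      refine Finset.sum_congr rfl fun a _ => ?_
      rw [Finset.mul_sum]
      refine Finset.sum_congr rfl fun f _ => ?_
      rw [Finset.mul_sum]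
      refine Finset.sum_congr rfl fun g _ => ?_
      rw [List.ofFn_cons, List.map_cons, List.prod_cons, Algebra.mul_smul_comm]
      congr 1
      have hcomm : Commute (v₂ b) (v₁ a * ((List.ofFn f).map v₁).prod) := by
        refine Commute.mul_right (hc a b).symm (Commute.list_prod_right _ _ fun x hx => ?_)
        rw [List.mem_map] at hx
        obtain ⟨a', -, rfl⟩ := hx
        exact (hc a' b).symm
      rw [← mul_assoc, hcomm.eq, mul_assoc]
    simp only [step]
    rw [Finset.sum_comm]
    refine Finset.sum_congr rfl fun a _ => ?_
    rw [Finset.sum_comm]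
  rw [h1, hA, hB, ← Finset.sum_add_distrib]
  refine Finset.sum_congr rfl fun a _ => ?_
  rw [← Finset.sum_add_distrib]
  refine Finset.sum_congr rfl fun f _ => ?_
  rw [← Finset.sum_add_distrib]
  refine Finset.sum_congr rfl fun b _ => ?_
  rw [← Finset.sum_add_distrib]
  refine Finset.sum_congr rfl fun g _ => ?_
  rw [add_smul]

/-- **The substitution `x ↦ v₁(x) + v₂(x)` is the convolution `m ∘ (v₁ ⊗ v₂) ∘ Δ`**: for two
substitutions with mutually commuting values,
`evalW n (v₁ + v₂) φ = Σ_{i+j=n} Σ_{|u|=i,|u'|=j} Sh_φ(u,u') v₁(u) v₂(u')`. Proof by induction on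
`n` through the left derivatives (`evalW_succ`, the transposed shuffle recursion).
[cite: Reutenauer1993, §1.5] -/
theorem evalW_add_eq_sum_shEval₂ {v₁ v₂ : α → A} (hc : ∀ a b, Commute (v₁ a) (v₂ b)) :
    ∀ (n : ℕ) (φ : NCSeries α R), evalW n (v₁ + v₂) φ =
      ∑ p ∈ Finset.HasAntidiagonal.antidiagonal n, shEval₂ p.1 p.2 v₁ v₂ φ
  | 0, φ => by simp
  | n + 1, φ => by
    -- the left and right parts of a graded piece
    let L : ℕ → ℕ → A := fun i j =>
      match i with
      | 0 => 0
      | i + 1 => ∑ a : α, v₁ a * shEval₂ i j v₁ v₂ (lderiv a φ)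
    let Rt : ℕ → ℕ → A := fun i j =>
      match j with
      | 0 => 0
      | j + 1 => ∑ b : α, v₂ b * shEval₂ i j v₁ v₂ (lderiv b φ)
    have hsplit : ∀ p ∈ Finset.HasAntidiagonal.antidiagonal (n + 1),
        shEval₂ p.1 p.2 v₁ v₂ φ = L p.1 p.2 + Rt p.1 p.2 := by
      rintro ⟨i, j⟩ hp
      rw [Finset.HasAntidiagonal.mem_antidiagonal] at hp
      match i, j, hp with
      | 0, j + 1, _ => simp only [L, Rt, shEval₂_zero_succ, zero_add]
      | i + 1, 0, _ => simp only [L, Rt, shEval₂_succ_zero, add_zero]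
      | i + 1, j + 1, _ => simp only [L, Rt, shEval₂_succ_succ i j hc]
    have hLsum : ∑ p ∈ Finset.HasAntidiagonal.antidiagonal (n + 1), L p.1 p.2 =
        ∑ a : α, v₁ a * ∑ q ∈ Finset.HasAntidiagonal.antidiagonal n,
          shEval₂ q.1 q.2 v₁ v₂ (lderiv a φ) := by
      rw [Finset.Nat.sum_antidiagonal_succ]
      simp only [L, zero_add, Finset.mul_sum]
      exact Finset.sum_comm
    have hRsum : ∑ p ∈ Finset.HasAntidiagonal.antidiagonal (n + 1), Rt p.1 p.2 =
        ∑ b : α, v₂ b * ∑ q ∈ Finset.HasAntidiagonal.antidiagonal n,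
          shEval₂ q.1 q.2 v₁ v₂ (lderiv b φ) := by
      rw [Finset.Nat.sum_antidiagonal_succ']
      simp only [Rt, zero_add, Finset.mul_sum]
      exact Finset.sum_comm
    rw [Finset.sum_congr rfl hsplit, Finset.sum_add_distrib, hLsum, hRsum, evalW_succ,
      ← Finset.sum_add_distrib]
    refine Finset.sum_congr rfl fun a _ => ?_
    rw [evalW_add_eq_sum_shEval₂ hc n (lderiv a φ), Pi.add_apply, add_mul]

/-- **Exponential law for group-like series** ("group-like elements are characters";
[Reutenauer1993, Thm 3.2]): if `φ` is group-like and the values of `v₁` commute with those of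
`v₂`, then `evalW n (v₁ + v₂) φ = Σ_{i+j=n} evalW i v₁ φ · evalW j v₂ φ`, i.e. weight by weight
`φ(v₁ + v₂) = φ(v₁) φ(v₂)`. [cite: Reutenauer1993, Thm 3.2] -/
theorem IsGroupLike.evalW_add {φ : NCSeries α R} (hφ : IsGroupLike φ) {v₁ v₂ : α → A}
    (hc : ∀ a b, Commute (v₁ a) (v₂ b)) (n : ℕ) :
    evalW n (v₁ + v₂) φ =
      ∑ p ∈ Finset.HasAntidiagonal.antidiagonal n, evalW p.1 v₁ φ * evalW p.2 v₂ φ := by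
  rw [evalW_add_eq_sum_shEval₂ hc n φ]
  refine Finset.sum_congr rfl fun p _ => ?_
  rw [shEval₂, evalW, evalW, Finset.sum_mul_sum]
  refine Finset.sum_congr rfl fun f _ => Finset.sum_congr rfl fun g _ => ?_
  rw [shPair, ← hφ.2, smul_mul_smul_comm]

/-- **Truncated exponential law**: under the truncation hypothesis (values in a submodule `S`
whose products of more than `N` factors vanish), `evalTrunc N (v₁ + v₂) φ =
evalTrunc N v₁ φ · evalTrunc N v₂ φ` for group-like `φ` and mutually commuting `v₁`, `v₂`.
[cite: Reutenauer1993, Thm 3.2] -/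
theorem IsGroupLike.evalTrunc_add (S : Submodule R A) {N : ℕ}
    (hS : ∀ l : List A, (∀ x ∈ l, x ∈ S) → N < l.length → l.prod = 0)
    {φ : NCSeries α R} (hφ : IsGroupLike φ) {v₁ v₂ : α → A} (hv₁ : ∀ a, v₁ a ∈ S)
    (hv₂ : ∀ a, v₂ a ∈ S) (hc : ∀ a b, Commute (v₁ a) (v₂ b)) :
    evalTrunc N (v₁ + v₂) φ = evalTrunc N v₁ φ * evalTrunc N v₂ φ := by
  simp only [evalTrunc_eq_sum_evalW, hφ.evalW_add hc, Finset.sum_mul_sum]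
  rw [sum_range_sum_antidiagonal (fun i j => evalW i v₁ φ * evalW j v₂ φ) N]
  refine Finset.sum_congr rfl fun i hi => ?_
  rw [Finset.mem_range] at hi
  refine Finset.sum_subset (Finset.range_subset_range.mpr (by omega)) fun j hj hj' => ?_
  rw [Finset.mem_range] at hj hj'
  rw [evalW, evalW, Finset.sum_mul_sum]
  refine Finset.sum_eq_zero fun f _ => Finset.sum_eq_zero fun g _ => ?_
  rw [smul_mul_smul_comm, ← List.prod_append, hS _ (fun x hx => ?_) (by simp; omega), smul_zero]
  simp only [List.mem_append, List.mem_map] at hx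
  rcases hx with ⟨a, -, rfl⟩ | ⟨a, -, rfl⟩
  · exact hv₁ a
  · exact hv₂ a

end Shuffle

/-! ## B.1.3 Two letters: `φ(A + C, B + D) = φ(A, B) φ(C, D)`, `φ(A, 0) = 1`, shift invariance -/

section TwoLetters

variable {R : Type v} [CommRing R] {A : Type*} [Ring A] [Algebra R A]

/-- `bsub (A + C) (B + D) = bsub A B + bsub C D` pointwise. [folklore] -/
theorem bsub_add (a b c d : A) : bsub (a + c) (b + d) = bsub a b + bsub c d := by
  funext x; cases x <;> rfl

/-- **`φ(A, 0) = 1`** when `c_∅(φ) = 1` and `c_{X₀ⁿ}(φ) = 0` for `n ≥ 1`. [folklore] -/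
theorem subst₂_zero_right {φ : NCSeries Bool R} (h0 : φ [] = 1)
    (hX : ∀ n, 1 ≤ n → φ (List.replicate n false) = 0) (N : ℕ) (a : A) : subst₂ N φ a 0 = 1 := by
  rw [subst₂, evalTrunc, Finset.sum_eq_single_of_mem 0 (by simp) fun n _ hn => ?_]
  · simp [h0]
  · refine Finset.sum_eq_zero fun f _ => ?_
    by_cases ht : true ∈ List.ofFn f
    · rw [prod_map_bsub_zero_right_eq_zero a ht, smul_zero]
    · have hf : List.ofFn f = List.replicate n false := by
        refine List.eq_replicate_iff.mpr ⟨List.length_ofFn, fun b hb => ?_⟩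
        cases b
        · rfl
        · exact absurd hb ht
      rw [hf, hX n (Nat.one_le_iff_ne_zero.mpr hn), zero_smul]

/-- **`φ(0, B) = 1`** when `c_∅(φ) = 1` and `c_{X₁ⁿ}(φ) = 0` for `n ≥ 1`. [folklore] -/
theorem subst₂_zero_left {φ : NCSeries Bool R} (h0 : φ [] = 1)
    (hY : ∀ n, 1 ≤ n → φ (List.replicate n true) = 0) (N : ℕ) (b : A) : subst₂ N φ 0 b = 1 := by
  rw [subst₂, evalTrunc, Finset.sum_eq_single_of_mem 0 (by simp) fun n _ hn => ?_]
  · simp [h0]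
  · refine Finset.sum_eq_zero fun f _ => ?_
    by_cases hf' : false ∈ List.ofFn f
    · rw [prod_map_bsub_zero_left_eq_zero b hf', smul_zero]
    · have hf : List.ofFn f = List.replicate n true := by
        refine List.eq_replicate_iff.mpr ⟨List.length_ofFn, fun c hc => ?_⟩
        cases c
        · exact absurd hc hf'
        · rfl
      rw [hf, hY n (Nat.one_le_iff_ne_zero.mpr hn), zero_smul]

/-- In weight `(1, n)`: `c_a(φ) c_{aⁿ}(φ) = (n+1) c_{aⁿ⁺¹}(φ)` for group-like `φ`
(the `n + 1` interleavings of `a` with `aⁿ` all equal `aⁿ⁺¹`). [folklore] -/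
theorem IsGroupLike.apply_singleton_mul_replicate {α : Type u} {φ : NCSeries α R}
    (hφ : IsGroupLike φ) (a : α) (n : ℕ) :
    φ [a] * φ (List.replicate n a) = ((n + 1 : ℕ) : R) * φ (List.replicate (n + 1) a) := by
  rw [hφ.2, shuffleWord_singleton_replicate, List.map_replicate, List.sum_replicate, nsmul_eq_mul]

variable [Algebra ℚ R]

/-- In a `ℚ`-algebra, `(m+1) x = 0` forces `x = 0`. [folklore] -/
theorem eq_zero_of_nat_succ_mul_eq_zero {x : R} (m : ℕ) (h : ((m + 1 : ℕ) : R) * x = 0) :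
    x = 0 := by
  have hinv : algebraMap ℚ R (1 / (m + 1 : ℚ)) * ((m + 1 : ℕ) : R) = 1 := by
    rw [← map_natCast (algebraMap ℚ R), ← map_mul, ← map_one (algebraMap ℚ R)]
    congr 1
    push_cast
    field_simp
  calc x = algebraMap ℚ R (1 / (m + 1 : ℚ)) * ((m + 1 : ℕ) : R) * x := by rw [hinv, one_mul]
    _ = 0 := by rw [mul_assoc, h, mul_zero]

variable (S : Submodule R A) {N : ℕ}

omit [Algebra ℚ R] in
/-- **`φ(A + C, B + D) = φ(A, B) φ(C, D)`** for group-like `φ` when `A, B` commute with `C, D`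
(all four in a submodule `S` whose products of more than `N` factors vanish): the exponential law
`IsGroupLike.evalTrunc_add` for the two letters `X₀ ↦ A + C`, `X₁ ↦ B + D`.
[cite: Reutenauer1993, Thm 3.2] -/
theorem IsGroupLike.subst₂_add_add
    (hS : ∀ l : List A, (∀ x ∈ l, x ∈ S) → N < l.length → l.prod = 0)
    {φ : NCSeries Bool R} (hφ : IsGroupLike φ) {a b c d : A} (ha : a ∈ S) (hb : b ∈ S) (hc : c ∈ S)
    (hd : d ∈ S) (hac : Commute a c) (had : Commute a d) (hbc : Commute b c) (hbd : Commute b d) :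
    subst₂ N φ (a + c) (b + d) = subst₂ N φ a b * subst₂ N φ c d := by
  rw [subst₂, subst₂, subst₂, bsub_add]
  refine hφ.evalTrunc_add S hS (fun x => ?_) (fun x => ?_) fun x y => ?_
  · cases x <;> assumption
  · cases x <;> assumption
  · cases x <;> cases y <;> assumption

/-- **Furusho's remark** [Furusho2010, proof of Lemma 5]: "if `φ` is commutator group-like,
`φ(A + C, B) = φ(A, B)` with `[A, C] = [B, C] = 0`" (here: `φ` group-like with `c_{X₀}(φ) = 0`,
in a weight-truncated algebra over a `ℚ`-algebra). [cite: Furusho2010, Lemma 5 (proof)] -/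
theorem IsGroupLike.subst₂_add_left
    (hS : ∀ l : List A, (∀ x ∈ l, x ∈ S) → N < l.length → l.prod = 0)
    {φ : NCSeries Bool R} (hφ : IsGroupLike φ) (hX : φ [false] = 0) {a b c : A} (ha : a ∈ S)
    (hb : b ∈ S) (hc : c ∈ S) (hac : Commute a c) (hbc : Commute b c) :
    subst₂ N φ (a + c) b = subst₂ N φ a b := by
  have h := hφ.subst₂_add_add S hS ha hb hc (zero_mem S) hac (Commute.zero_right a) hbc
    (Commute.zero_right b)
  rwa [add_zero,
    subst₂_zero_right hφ.1 (fun n hn => hφ.apply_replicate_eq_zero hX n (by omega)) N c,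
    mul_one] at h

/-- **Furusho's remark** [Furusho2010, proof of Lemma 5]: "`φ(A, B + C) = φ(A, B)` with
`[A, C] = [B, C] = 0`" for `φ` group-like with `c_{X₁}(φ) = 0`.
[cite: Furusho2010, Lemma 5 (proof)] -/
theorem IsGroupLike.subst₂_add_right
    (hS : ∀ l : List A, (∀ x ∈ l, x ∈ S) → N < l.length → l.prod = 0)
    {φ : NCSeries Bool R} (hφ : IsGroupLike φ) (hY : φ [true] = 0) {a b c : A} (ha : a ∈ S)
    (hb : b ∈ S) (hc : c ∈ S) (hac : Commute a c) (hbc : Commute b c) :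
    subst₂ N φ a (b + c) = subst₂ N φ a b := by
  have h := hφ.subst₂_add_add S hS ha hb (zero_mem S) hc (Commute.zero_right a) hac
    (Commute.zero_right b) hbc
  rwa [add_zero,
    subst₂_zero_left hφ.1 (fun n hn => hφ.apply_replicate_eq_zero hY n (by omega)) N c,
    mul_one] at h

/-- **`φ(A, B) = 1` for commuting `A, B`** when `φ` is group-like with
`c_{X₀}(φ) = c_{X₁}(φ) = 0` (commutator group-like): `φ(A, B) = φ(A, 0) φ(0, B) = 1`.
Used to read the 2-cycle relation off the pentagon [Furusho2010, Lemma 6]. [folklore] -/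
theorem IsGroupLike.subst₂_eq_one_of_commute
    (hS : ∀ l : List A, (∀ x ∈ l, x ∈ S) → N < l.length → l.prod = 0)
    {φ : NCSeries Bool R} (hφ : IsGroupLike φ) (hX : φ [false] = 0) (hY : φ [true] = 0) {a b : A}
    (ha : a ∈ S) (hb : b ∈ S) (hab : Commute a b) : subst₂ N φ a b = 1 := by
  have h := hφ.subst₂_add_add S hS ha (zero_mem S) (zero_mem S) hb (Commute.zero_right a) hab
    (Commute.zero_right 0) (Commute.zero_left b)
  rwa [add_zero, zero_add,
    subst₂_zero_right hφ.1 (fun n hn => hφ.apply_replicate_eq_zero hX n (by omega)) N a,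
    subst₂_zero_left hφ.1 (fun n hn => hφ.apply_replicate_eq_zero hY n (by omega)) N b,
    mul_one] at h

end TwoLetters

end NCSeries

end Literature.NumberTheory.Transcendental
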